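import Literature.Computability.AlgebraicComplexity.IK2020PowerSumInvariantsDecompositionProofs
import Literature.Computability.AlgebraicComplexity.IK2020OrbitClosureInvariantBound
import HarnessLib

/-!
# Ikenmeyer–Kandasamy 2020, Lemma 5.2 (`lem:cormain`): the computation `e_Ξ = e` and the
reduction of Lemma 5.2 to Thm. 4.2 and Prop. 10.1 (proofs)

Theorem-only companion of `IK20HighestWeightVectors.lean`. IK Lemma 5.2 (TeX L510–527) states
`mult_{(λ+(m×eD))^*} ℂ[\overline{Gp}] = mult_{λ^*} ℂ[Gp]` for the explicit number
`e = eCormain m d D`; its printed proof (TeX L528–558) is: Thm. 4.2 with `Ξ` = all `ϱ ⊢_m d` and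
Prop. 4.1 give `≥`, the inclusion `ℂ[\overline{Gp}] ⊆ ℂ[Gp]` and Lemma 5.1 give `≤`, and "It remains
to show that `e_Ξ = e`" — an elementary maximisation of `e_ϱ` over `ϱ ⊢_m d` (TeX L537–558). Here:

* `IK2020.eXi_univ_eq_eCormain`: `e_Ξ = e` for `Ξ` = all partitions of `d` with at most `m` parts
  (`D ≥ 3`, `m ≥ 1`), PROVED as printed (upper bound `∑⌈ϱ_i/(D-2)⌉ = m' + ∑⌊(ϱ_i-1)/(D-2)⌋ ≤
  m + ⌊(d-m)/(D-2)⌋`, witnesses `(1,…,1)` and `(1+d-m,1,…,1)`; the odd case with `2(D-2)`).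
* `IK2020_lemma_5_2_of_thm_4_2_of_prop_10_1 : IK2020_thm_4_2 → IK2020_prop_10_1 → IK2020_lemma_5_2`:
  the printed proof, with the `≤` half `IK2020_lemma_5_2_le` (file
  `IK2020OrbitClosureInvariantBound`) and Prop. 4.1 in the form `IK2020_prop_4_1_of_prop_10_1`
  (file `IK2020PowerSumInvariantsDecompositionProofs`).

No new definitions, no named facts.

## References
* C. Ikenmeyer, U. Kandasamy, arXiv:1911.03990, Lemma 5.2 and its proof (TeX L510–558).
  [IkenmeyerKandasamy2019]
-/

open scoped BigOperators

namespace Literature.Computability.AlgebraicComplexity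

open _root_.Literature.NumberTheory.DiophantineGeometry

namespace IK2020

/-! ## §1. Arithmetic of `⌈r/b⌉` and of `∑_i ⌈ϱ_i/b⌉` -/

/-- `⌈r/b⌉ = ⌊(r-1)/b⌋ + 1` for `r, b ≥ 1` (IK, proof of Lemma 5.2, TeX L536: "for natural numbers
`a, b` we have `⌈(1+a)/b⌉ - 1 = ⌊a/b⌋`"). [folklore] -/
private theorem ceilDiv_eq_div_add_one {r b : ℕ} (hr : 1 ≤ r) (hb : 1 ≤ b) :
    ceilDiv r b = (r - 1) / b + 1 := by
  unfold ceilDiv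
  rw [show r + (b - 1) = (r - 1) + b by omega, Nat.add_div_right _ (by omega)]

/-- `⌈r/b⌉ ≤ r` for `b ≥ 1`. [folklore] -/
private theorem ceilDiv_le_self (r : ℕ) {b : ℕ} (hb : 1 ≤ b) : ceilDiv r b ≤ r := by
  unfold ceilDiv
  rcases Nat.eq_zero_or_pos r with rfl | hr
  · rw [zero_add, Nat.div_eq_of_lt (by omega)]
  · apply Nat.div_le_of_le_mul
    have h1 : (b - 1) * 1 ≤ (b - 1) * r := Nat.mul_le_mul_left _ hr
    calc r + (b - 1) ≤ r + (b - 1) * r := by omega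
      _ = b * r := by
          conv_rhs => rw [show b = (b - 1) + 1 by omega]
          ring

/-- `⌈1/b⌉ = 1` for `b ≥ 1`. [folklore] -/
private theorem ceilDiv_one {b : ℕ} (hb : 1 ≤ b) : ceilDiv 1 b = 1 := by
  rw [ceilDiv_eq_div_add_one le_rfl hb, Nat.sub_self, Nat.zero_div]

/-- `∑ ⌊f(r)/b⌋ ≤ ⌊(∑ f(r))/b⌋`. [folklore] -/
private theorem sum_map_div_le (P : Multiset ℕ) (f : ℕ → ℕ) (b : ℕ) :
    (P.map fun r => f r / b).sum ≤ (P.map f).sum / b := by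
  induction P using Multiset.induction_on with
  | empty => simp
  | cons a P ih =>
    rw [Multiset.map_cons, Multiset.sum_cons, Multiset.map_cons, Multiset.sum_cons]
    exact le_trans (Nat.add_le_add_left ih _) (Nat.add_div_le_add_div _ _ _)

/-- `∑ (r - 1) + #P = ∑ r` when all `r ≥ 1`. [folklore] -/
private theorem sum_map_sub_one_add_card (P : Multiset ℕ) (hP : ∀ r ∈ P, 1 ≤ r) :
    (P.map fun r => r - 1).sum + Multiset.card P = P.sum := by
  induction P using Multiset.induction_on with
  | empty => simp
  | cons a P ih =>
    rw [Multiset.map_cons, Multiset.sum_cons, Multiset.card_cons, Multiset.sum_cons,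
      ← ih fun r hr => hP r (Multiset.mem_cons_of_mem hr)]
    have ha := hP a (Multiset.mem_cons_self a P)
    omega

/-- `c ↦ c + ⌊(d-c)/b⌋` is non-decreasing on `c ≤ d` (`b ≥ 1`). [folklore] -/
private theorem add_div_mono {b c c' d : ℕ} (hb : 1 ≤ b) (hcc' : c ≤ c') (hc'd : c' ≤ d) :
    c + (d - c) / b ≤ c' + (d - c') / b := by
  have e2 : c' - c ≤ (c' - c) * b := Nat.le_mul_of_pos_right _ hb
  have h1 : (d - c) / b ≤ ((d - c') + (c' - c) * b) / b := Nat.div_le_div_right (by omega)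
  rw [Nat.add_mul_div_right _ _ (by omega)] at h1
  omega

/-- **Upper bound, "`d ≤ m`" case**: `∑_i ⌈ϱ_i/b⌉ ≤ ∑_i ϱ_i`. [folklore] -/
private theorem sum_ceilDiv_le_sum (P : Multiset ℕ) {b : ℕ} (hb : 1 ≤ b) :
    (P.map fun r => ceilDiv r b).sum ≤ P.sum := by
  conv_rhs => rw [← Multiset.map_id P]
  exact Multiset.sum_map_le_sum_map _ _ fun r _ => ceilDiv_le_self r hb

/-- **Upper bound, "`d ≥ m`" case** (IK TeX L544–548):
`∑_i ⌈ϱ_i/b⌉ = #ϱ + ∑_i ⌊(ϱ_i-1)/b⌋ ≤ #ϱ + ⌊(d-#ϱ)/b⌋ ≤ m + ⌊(d-m)/b⌋` for `ϱ ⊢ d` with `#ϱ ≤ m ≤ d`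
positive parts. [folklore] -/
private theorem sum_ceilDiv_le_of_card_le (P : Multiset ℕ) (hP : ∀ r ∈ P, 1 ≤ r) {b m : ℕ}
    (hb : 1 ≤ b) (hcard : Multiset.card P ≤ m) (hm : m ≤ P.sum) :
    (P.map fun r => ceilDiv r b).sum ≤ m + (P.sum - m) / b := by
  have h1 : (P.map fun r => ceilDiv r b) = P.map fun r => (r - 1) / b + 1 :=
    Multiset.map_congr rfl fun r hr => ceilDiv_eq_div_add_one (hP r hr) hb
  rw [h1, Multiset.sum_map_add]
  simp only [Multiset.map_const', Multiset.sum_replicate, smul_eq_mul, mul_one]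
  have h2 := sum_map_div_le P (fun r => r - 1) b
  have h3 := sum_map_sub_one_add_card P hP
  have h4 : (P.map fun r => r - 1).sum = P.sum - Multiset.card P := by omega
  rw [h4] at h2
  calc (P.map fun r => (r - 1) / b).sum + Multiset.card P
      ≤ Multiset.card P + (P.sum - Multiset.card P) / b := by omega
    _ ≤ m + (P.sum - m) / b := add_div_mono hb hcard hm

/-- **Witness `(1, …, 1)`**: `∑ ⌈1/b⌉ = d`. [folklore] -/
private theorem sum_ceilDiv_replicate_one (d : ℕ) {b : ℕ} (hb : 1 ≤ b) :
    ((Multiset.replicate d 1).map fun r => ceilDiv r b).sum = d := by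
  rw [Multiset.map_replicate, ceilDiv_one hb, Multiset.sum_replicate, smul_eq_mul, mul_one]

/-- **Witness `(1+d-m, 1, …, 1)`** (IK TeX L543): `⌈(1+d-m)/b⌉ + (m-1) = m + ⌊(d-m)/b⌋`.
[folklore] -/
private theorem sum_ceilDiv_witness {d m b : ℕ} (hb : 1 ≤ b) (hm : 1 ≤ m) (hmd : m ≤ d) :
    (((1 + (d - m)) ::ₘ Multiset.replicate (m - 1) 1).map fun r => ceilDiv r b).sum =
      m + (d - m) / b := by
  rw [Multiset.map_cons, Multiset.sum_cons, sum_ceilDiv_replicate_one _ hb,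
    ceilDiv_eq_div_add_one (by omega) hb, show 1 + (d - m) - 1 = d - m by omega]
  omega

/-! ## §2. `e_Ξ = e` (IK, proof of Lemma 5.2, TeX L536–558) -/

/-- The partition `(1, …, 1) ⊢ d`. [folklore] -/
private theorem parts_ofSums_replicate_one (d : ℕ) :
    (Nat.Partition.ofSums d (Multiset.replicate d 1) (by simp)).parts = Multiset.replicate d 1 := by
  change (Multiset.replicate d 1).filter (· ≠ 0) = _
  exact Multiset.filter_eq_self.mpr fun r hr => by
    rw [Multiset.eq_of_mem_replicate hr]; exact one_ne_zero

/-- The sum of `(1+d-m, 1, …, 1)` (`m` entries) is `d` for `1 ≤ m ≤ d`. [folklore] -/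
private theorem sum_witness {d m : ℕ} (hm : 1 ≤ m) (hmd : m ≤ d) :
    ((1 + (d - m)) ::ₘ Multiset.replicate (m - 1) 1).sum = d := by
  rw [Multiset.sum_cons, Multiset.sum_replicate, smul_eq_mul, mul_one]
  omega

/-- The partition `(1+d-m, 1, …, 1) ⊢ d` has the displayed parts. [folklore] -/
private theorem parts_ofSums_witness {d m : ℕ} (hm : 1 ≤ m) (hmd : m ≤ d) :
    (Nat.Partition.ofSums d ((1 + (d - m)) ::ₘ Multiset.replicate (m - 1) 1)
        (sum_witness hm hmd)).parts = (1 + (d - m)) ::ₘ Multiset.replicate (m - 1) 1 := by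
  change ((1 + (d - m)) ::ₘ Multiset.replicate (m - 1) 1).filter (· ≠ 0) = _
  exact Multiset.filter_eq_self.mpr fun r hr => by
    rcases Multiset.mem_cons.mp hr with rfl | hr
    · omega
    · rw [Multiset.eq_of_mem_replicate hr]; exact one_ne_zero

/-- `e_ϱ` as `c · ∑_i ⌈ϱ_i/b⌉` with `(c, b) = (1, D-2)` for `D` even and `(2, 2(D-2))` for `D` odd
(unfolding `IK2020.eRho`). [folklore] -/
private theorem eRho_eq (D : ℕ) (P : Multiset ℕ) :
    eRho D P = if Even D then (P.map fun r => ceilDiv r (D - 2)).sum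
      else 2 * (P.map fun r => ceilDiv r (2 * (D - 2))).sum := by
  unfold eRho
  split_ifs
  · rfl
  · rw [Multiset.sum_map_mul_left]

/-- **IK, proof of Lemma 5.2 (TeX L536–558): `e_Ξ = e`.** For `D ≥ 3`, `m ≥ 1` and `Ξ` the set of
all partitions `ϱ ⊢ d` with at most `m` parts, `e_Ξ = max_{ϱ ∈ Ξ} e_ϱ` equals IK's explicit
`e = eCormain m d D` ("Let `D` be even and `d ≤ m`. Then the number of nonzero `ϱ_i` is at most `d`.
Hence `e_ϱ ≤ d`. On the other hand, `ϱ = (1,…,1,0,…,0)` provides `e_ϱ = d` … Let `D` be even and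
`d ≥ m`. Then `ϱ = (1+d-m,1,…,1)` provides `e_ϱ = m + ⌊(d-m)/(D-2)⌋`. The upper bound is provided via
`e_ϱ = ∑⌈ϱ_i/(D-2)⌉ = m + ∑⌊(ϱ_i-1)/(D-2)⌋ ≤ m + ⌊(d-m)/(D-2)⌋`", and the odd case with `2(D-2)`).
[cite: IkenmeyerKandasamy2019, Lemma 5.2 (proof)] -/
theorem eXi_univ_eq_eCormain {m d D : ℕ} (hD : 3 ≤ D) (hm : 1 ≤ m) :
    eXi D ((Finset.univ : Finset (Nat.Partition d)).filter (fun ρ => ρ.parts.card ≤ m)) =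
      eCormain m d D := by
  classical
  have hb : 1 ≤ D - 2 := by omega
  have hb' : 1 ≤ 2 * (D - 2) := by omega
  -- upper bound for every `ϱ`
  have upper : ∀ ρ : Nat.Partition d, ρ.parts.card ≤ m → eRho D ρ.parts ≤ eCormain m d D := by
    intro ρ hρ
    have hpos : ∀ r ∈ ρ.parts, 1 ≤ r := fun r hr => ρ.parts_pos hr
    rw [eRho_eq]
    unfold eCormain
    by_cases hev : Even D
    · rw [if_pos hev, if_pos hev]
      by_cases hdm : d ≤ m
      · rw [if_pos hdm]
        exact (sum_ceilDiv_le_sum _ hb).trans_eq ρ.parts_sum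
      · rw [if_neg hdm]
        have h := sum_ceilDiv_le_of_card_le ρ.parts hpos hb hρ (by rw [ρ.parts_sum]; omega)
        rwa [ρ.parts_sum] at h
    · rw [if_neg hev, if_neg hev]
      by_cases hdm : d ≤ m
      · rw [if_pos hdm]
        exact Nat.mul_le_mul_left 2 ((sum_ceilDiv_le_sum _ hb').trans_eq ρ.parts_sum)
      · rw [if_neg hdm]
        have h := sum_ceilDiv_le_of_card_le ρ.parts hpos hb' hρ (by rw [ρ.parts_sum]; omega)
        rw [ρ.parts_sum] at h
        calc 2 * (ρ.parts.map fun r => ceilDiv r (2 * (D - 2))).sum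
            ≤ 2 * (m + (d - m) / (2 * (D - 2))) := Nat.mul_le_mul_left 2 h
          _ = 2 * m + 2 * ((d - m) / (2 * (D - 2))) := by ring
  -- a witness attaining the bound
  have witness : ∃ ρ : Nat.Partition d, ρ.parts.card ≤ m ∧ eRho D ρ.parts = eCormain m d D := by
    by_cases hdm : d ≤ m
    · refine ⟨Nat.Partition.ofSums d (Multiset.replicate d 1) (by simp), ?_, ?_⟩
      · rw [parts_ofSums_replicate_one, Multiset.card_replicate]
        exact hdm
      · rw [parts_ofSums_replicate_one, eRho_eq]
        unfold eCormain
        by_cases hev : Even D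
        · rw [if_pos hev, if_pos hev, if_pos hdm, sum_ceilDiv_replicate_one _ hb]
        · rw [if_neg hev, if_neg hev, if_pos hdm, sum_ceilDiv_replicate_one _ hb']
    · have hmd : m ≤ d := by omega
      refine ⟨Nat.Partition.ofSums d ((1 + (d - m)) ::ₘ Multiset.replicate (m - 1) 1)
        (sum_witness hm hmd), ?_, ?_⟩
      · rw [parts_ofSums_witness hm hmd, Multiset.card_cons, Multiset.card_replicate]
        omega
      · rw [parts_ofSums_witness hm hmd, eRho_eq]
        unfold eCormain
        by_cases hev : Even D
        · rw [if_pos hev, if_pos hev, if_neg hdm, sum_ceilDiv_witness hb hm hmd]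
        · rw [if_neg hev, if_neg hev, if_neg hdm, sum_ceilDiv_witness hb' hm hmd]
          ring
  unfold eXi
  apply le_antisymm
  · exact Finset.sup_le fun ρ hρ => upper ρ (Finset.mem_filter.mp hρ).2
  · obtain ⟨ρ, hρ, heq⟩ := witness
    rw [← heq]
    exact Finset.le_sup (f := fun ρ : Nat.Partition d => eRho D ρ.parts)
      (Finset.mem_filter.mpr ⟨Finset.mem_univ ρ, hρ⟩)

end IK2020

open IK2020 in
/-- **The printed proof of IK Lemma 5.2 (TeX L528–535) modulo Thm. 4.2 and Prop. 10.1.**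
"Let `Ξ` denote the set of all partitions `ϱ ⊢_m d`. Using Theorem 4.2, then according to
Proposition 4.1 we have `mult_{(λ+(m×e_Ξ D))^*} ℂ[\overline{Gp}] ≥ mult_{λ^*} ℂ[Gp]`. Using Lemma 5.1 …
`mult_{(λ+(m×e_Ξ D))^*} ℂ[\overline{Gp}] = mult_{λ^*} ℂ[Gp]`. It remains to show that `e_Ξ = e`."
Tree: `≤` is `IK2020_lemma_5_2_le` (unconditional), Prop. 4.1 is `IK2020_prop_4_1_of_prop_10_1`,
and `e_Ξ = e` is `IK2020.eXi_univ_eq_eCormain`. Hence the named fact `IK2020_lemma_5_2` follows from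
the named facts `IK2020_thm_4_2` and `IK2020_prop_10_1`.
[cite: IkenmeyerKandasamy2019, Lemma 5.2 (proof)] -/
theorem IK2020_lemma_5_2_of_thm_4_2_of_prop_10_1 (h42 : IK2020_thm_4_2)
    (h101 : IK2020_prop_10_1) : IK2020_lemma_5_2 := by
  intro m d D hD hDm hodd lam h
  apply le_antisymm (IK2020_lemma_5_2_le m d D hD lam h)
  have h41 := IK2020_prop_4_1_of_prop_10_1 h101 m D d hD hDm lam h
  have hmain := h42 m d D hD hDm hodd lam h
    ((Finset.univ : Finset (Nat.Partition d)).filter (fun ρ => ρ.parts.card ≤ m))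
    (fun ρ hρ => (Finset.mem_filter.mp hρ).2)
  rw [eXi_univ_eq_eCormain hD (by omega), ← h41] at hmain
  exact hmain

end Literature.Computability.AlgebraicComplexity
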